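import Mathlib
import Summits.NavierStokesRegularity.NavierStokesRegularity.Theorems.FilamentSkeletonRssStadiumBaseMargin
import Summits.NavierStokesRegularity.NavierStokesRegularity.Theorems.FilamentSkeletonRssStadiumMarginKernel
import Summits.NavierStokesRegularity.NavierStokesRegularity.Theorems.FilamentSkeletonRssStadiumFixedSourcePiece

/-!
# The frozen CONNECTOR piece is holomorphic (`TangentSkeletonNearStraightL`, stmt-NavierStokesRegularity-23320, registered stub
# `stub_stripPropagation` — blueprint item R2, connectors, of `DIAG-addendum-contour-g2.md`)

The two fixed vertical connectors `x₀ + it`, `t ∈ [a,b]` (`x₀ = c_j ± (L + 8h)`, `[a,b] = [0, Im z₀]` reordered) are at horizontal distance `≥ r₀`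
(`= 7h`) from every target `z` of the ball `|z − z₀| < δ`, and the height differences are `≤ m·r₀` (`m ≤ 1/7·(1 + δ/h)`), so every pair is SLOPED
and Theorems.StadiumContourPositivityAbs.pair_base_re_ge_slope_abs gives the uniform margin `r₀²·C + κΛ⁻¹/2` directly (no near-diagonal case).  With
the constant majorant of Theorems.StadiumMarginKernel and clamp-continuous data, Theorems.StadiumFixedSourcePiece yields holomorphy of the frozen
connector integral `z ↦ ∫_{[a,b]} K(z, x₀ + it) dt` on the ball (`connectorPiece_differentiableOn`).  HONEST FRAMING: a tool for a HYPOTHETICAL filament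
skeleton on the NEGATIVE side of a MODEL route; nothing here bears on Navier–Stokes regularity or blow-up.  `--supports stmt-NavierStokesRegularity-23320`.
-/

set_option linter.dupNamespace false

noncomputable section

namespace Summit.NavierStokesRegularity.NavierStokesRegularity.Theorems.StadiumConnectorPiece

open Set Metric MeasureTheory
open scoped InnerProductSpace Matrix
open Summit.NavierStokesRegularity.NavierStokesRegularity.Theorems.StadiumContourPositivityAbs
open Summit.NavierStokesRegularity.NavierStokesRegularity.Theorems.StadiumBaseMargin
open Summit.NavierStokesRegularity.NavierStokesRegularity.Theorems.StadiumMarginKernel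
open Summit.NavierStokesRegularity.NavierStokesRegularity.Theorems.StadiumChordCrude
open Summit.NavierStokesRegularity.NavierStokesRegularity.Theorems.StadiumFixedSourcePiece

/-- **The frozen connector piece is holomorphic on the ball of targets.**  See the module docstring. [folklore] -/
theorem connectorPiece_differentiableOn {hs L cc M Rb n m r₀ δ κ Λ a b x₀ : ℝ} {F : ℂ → (Fin 3 → ℂ)} {G : ℂ → ℂ}
    (hF : DifferentiableOn ℂ F {z : ℂ | |z.im| < hs ∧ |z.re - cc| < L + hs})
    (hunit : ∀ w ∈ {z : ℂ | |z.im| < hs ∧ |z.re - cc| < L + hs}, ∑ i, (deriv F w i) ^ 2 = 1)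
    (hM : ∀ z ∈ {z : ℂ | |z.im| < hs ∧ |z.re - cc| < L + hs}, ‖deriv F z‖ ≤ M)
    {X : ℝ → EuclideanSpace ℝ (Fin 3)} (hX : Differentiable ℝ X) (hXu : ∀ τ, ‖deriv X τ‖ = 1)
    (hosc : ∀ τ σ, ‖deriv X τ - deriv X σ‖ ≤ Rb)
    (hFX : ∀ r : ℝ, (r : ℂ) ∈ {z : ℂ | |z.im| < hs ∧ |z.re - cc| < L + hs} →
      F r = fun i => ((⟪X r, EuclideanSpace.single i (1:ℝ)⟫_ℝ : ℝ) : ℂ))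
    (hG : DifferentiableOn ℂ G {z : ℂ | |z.im| < hs ∧ |z.re - cc| < L + hs})
    (hGre : ∀ w ∈ {z : ℂ | |z.im| < hs ∧ |z.re - cc| < L + hs}, Λ⁻¹ / 2 ≤ (G w).re)
    (hn : 1 < n) (hκ : 0 < κ) (hΛ : 0 < Λ) (hab : a ≤ b) {z₀ : ℂ}
    -- the connector `x₀ + it`, `t ∈ [a,b]`: inside `S` with `n`-fold discs
    (hcoS : ∀ t ∈ Icc a b, ((x₀ : ℂ) + (t : ℂ) * Complex.I) ∈ {z : ℂ | |z.im| < hs ∧ |z.re - cc| < L + hs})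
    (hcofit : ∀ t ∈ Icc a b, n * |t| < hs ∧ |x₀ - cc| + n * |t| < L + hs)
    -- the targets
    (hballS : ball z₀ δ ⊆ {z : ℂ | |z.im| < hs ∧ |z.re - cc| < L + hs})
    (hballfit : ∀ z ∈ ball z₀ δ, n * |z.im| < hs ∧ |z.re - cc| + n * |z.im| < L + hs)
    -- geometry: horizontal distance ≥ r₀, height differences ≤ m r₀
    (hm0 : 0 ≤ m) (hm1 : m ≤ 1) (hr₀ : 0 < r₀) (hfarz : ∀ z ∈ ball z₀ δ, r₀ ≤ |z.re - x₀|)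
    (hheights : ∀ z ∈ ball z₀ δ, ∀ t ∈ Icc a b, |z.im - t| ≤ m * r₀)
    (hA : 0 ≤ 1 - (Rb + 2 * (√3 * (2 * M * (Real.log (n / (n - 1)) - 1 / n)))) ^ 2 / 2)
    (hC : 0 < (1 - m ^ 2) * (1 - (Rb + 2 * (√3 * (2 * M * (Real.log (n / (n - 1)) - 1 / n)))) ^ 2 / 2) -
      2 * m * (2 * (√3 * (M * Real.log (n / (n - 1)))) * (Rb + 2 * (√3 * (2 * M * (Real.log (n / (n - 1)) - 1 / n)))))) :
    DifferentiableOn ℂ (fun z => ∫ t in Icc a b,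
      (((∑ i, (F z i - F ((x₀ : ℂ) + (((max a (min t b) : ℝ)) : ℂ) * Complex.I) i) ^ 2) +
          (κ : ℂ) * G ((x₀ : ℂ) + (((max a (min t b) : ℝ)) : ℂ) * Complex.I)) ^ ((3:ℂ) / 2))⁻¹ •
        (deriv F ((x₀ : ℂ) + (((max a (min t b) : ℝ)) : ℂ) * Complex.I) ⨯₃
          (fun i => F z i - F ((x₀ : ℂ) + (((max a (min t b) : ℝ)) : ℂ) * Complex.I) i))) (ball z₀ δ) := by
  set S : Set ℂ := {z : ℂ | |z.im| < hs ∧ |z.re - cc| < L + hs} with hS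
  have hSo : IsOpen S := by
    have h1 : IsOpen {z : ℂ | |z.im| < hs} := isOpen_lt (continuous_abs.comp Complex.continuous_im) continuous_const
    have h2 : IsOpen {z : ℂ | |z.re - cc| < L + hs} :=
      isOpen_lt (continuous_abs.comp (Complex.continuous_re.sub continuous_const)) continuous_const
    exact h1.inter h2
  set cl : ℝ → ℝ := fun t => max a (min t b) with hcl
  have hcl_mem : ∀ t, cl t ∈ Icc a b := fun t => ⟨le_max_left _ _, max_le hab (min_le_right _ _)⟩
  set ζf : ℝ → ℂ := fun t => (x₀ : ℂ) + ((cl t : ℝ) : ℂ) * Complex.I with hζf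
  have hζS : ∀ t, ζf t ∈ S := fun t => hcoS _ (hcl_mem t)
  have hζim : ∀ t, (ζf t).im = cl t := fun t => by simp [hζf]
  have hζre : ∀ t, (ζf t).re = x₀ := fun t => by simp [hζf]
  -- continuity of the clamped data
  have hP : Continuous fun t : ℝ => F (ζf t) := continuous_connector_clamp hF.continuousOn hab hcoS
  have hdF : ContinuousOn (deriv F) S := ((hF.analyticOnNhd hSo).deriv).continuousOn
  have hD : Continuous fun t : ℝ => deriv F (ζf t) := continuous_connector_clamp hdF hab hcoS
  have hGc : Continuous fun t : ℝ => G (ζf t) := continuous_connector_clamp hG.continuousOn hab hcoS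
  -- the margin from sloped pairs
  set C : ℝ := (1 - m ^ 2) * (1 - (Rb + 2 * (√3 * (2 * M * (Real.log (n / (n - 1)) - 1 / n)))) ^ 2 / 2) -
      2 * m * (2 * (√3 * (M * Real.log (n / (n - 1)))) * (Rb + 2 * (√3 * (2 * M * (Real.log (n / (n - 1)) - 1 / n))))) with hCdef
  set m₀ : ℝ := r₀ ^ 2 * C with hm₀def
  have hm₀pos : 0 < m₀ := by positivity
  have hmargin : ∀ z ∈ ball z₀ δ, ∀ t : ℝ, m₀ ≤ ((∑ i, (F z i - F (ζf t) i) ^ 2) + (κ : ℂ) * G (ζf t)).re := by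
    intro z hz t
    obtain ⟨hzfit, hzfit'⟩ := hballfit z hz
    obtain ⟨hζfit, hζfit'⟩ := hcofit _ (hcl_mem t)
    have hζfit1 : n * |(ζf t).im| < hs := by rw [hζim]; exact hζfit
    have hζfit1' : |(ζf t).re - cc| + n * |(ζf t).im| < L + hs := by rw [hζim, hζre]; exact hζfit'
    have hre : r₀ ≤ |z.re - (ζf t).re| := by rw [hζre]; exact hfarz z hz
    have hslope : |z.im - (ζf t).im| ≤ m * |z.re - (ζf t).re| := by
      rw [hζim]
      exact (hheights z hz _ (hcl_mem t)).trans (mul_le_mul_of_nonneg_left (by rw [hζre]; exact hfarz z hz) hm0)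
    have h := pair_base_re_ge_slope_abs hF hunit hM hX hXu hosc hFX hn hzfit hzfit' hζfit1 hζfit1' hm0 hm1 hslope hA hκ.le
      (hGre _ (hζS t))
    rw [← hCdef] at h
    have h1 : r₀ ^ 2 * C ≤ (z.re - (ζf t).re) ^ 2 * C := by
      have : r₀ ^ 2 ≤ (z.re - (ζf t).re) ^ 2 := by
        have := pow_le_pow_left₀ hr₀.le hre 2; rwa [sq_abs] at this
      exact mul_le_mul_of_nonneg_right this hC.le
    have h2 : 0 ≤ κ * (Λ⁻¹ / 2) := by positivity
    rw [hm₀def]; linarith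
  have hpos : ∀ z ∈ ball z₀ δ, ∀ t ∈ Icc a b, 0 < ((∑ i, (F z i - F (ζf t) i) ^ 2) + (κ : ℂ) * G (ζf t)).re :=
    fun z hz t _ => lt_of_lt_of_le hm₀pos (hmargin z hz t)
  -- the dominating constant
  set R₁ : ℝ := δ + |z₀.re - x₀| + (|z₀.im - a| + |z₀.im - b|) with hR₁
  have hdist : ∀ z ∈ ball z₀ δ, ∀ t : ℝ, ‖z - ζf t‖ ≤ R₁ := by
    intro z hz t
    have hzz : ‖z - z₀‖ < δ := by rwa [mem_ball, dist_eq_norm] at hz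
    have h1 : ‖z₀ - ζf t‖ ≤ |z₀.re - x₀| + |z₀.im - cl t| := by
      have h := Complex.norm_le_abs_re_add_abs_im (z₀ - ζf t)
      rw [Complex.sub_re, Complex.sub_im, hζre, hζim] at h
      exact h
    have h3 : |z₀.im - cl t| ≤ |z₀.im - a| + |z₀.im - b| := by
      have hm := hcl_mem t
      rcases le_total (z₀.im) (cl t) with h | h
      · rw [abs_of_nonpos (by linarith)]
        have : |z₀.im - b| ≥ -(z₀.im - b) := neg_le_abs _
        linarith [hm.2, abs_nonneg (z₀.im - a)]
      · rw [abs_of_nonneg (by linarith)]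
        have : |z₀.im - a| ≥ z₀.im - a := le_abs_self _
        linarith [hm.1, abs_nonneg (z₀.im - b)]
    calc ‖z - ζf t‖ ≤ ‖z - z₀‖ + ‖z₀ - ζf t‖ := norm_sub_le_norm_sub_add_norm_sub _ _ _
      _ ≤ R₁ := by rw [hR₁]; linarith
  have hdom : ∀ z ∈ ball z₀ δ, ∀ t ∈ Icc a b,
      ‖(((∑ i, (F z i - F (ζf t) i) ^ 2) + (κ : ℂ) * G (ζf t)) ^ ((3:ℂ) / 2))⁻¹ •
        (deriv F (ζf t) ⨯₃ (fun i => F z i - F (ζf t) i))‖ ≤ m₀ ^ (-(3/2 : ℝ)) * (2 * M ^ 2 * R₁) := by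
    intro z hz t _
    have hzS : z ∈ S := hballS hz
    have hseg : segment ℝ (ζf t) z ⊆ S := (stadium_convex hs L cc).segment_subset (hζS t) hzS
    have hdiff : ∀ u ∈ segment ℝ (ζf t) z, DifferentiableAt ℂ F u := fun u hu => hF.differentiableAt (hSo.mem_nhds (hseg hu))
    have hMseg : ∀ u ∈ segment ℝ (ζf t) z, ‖deriv F u‖ ≤ M := fun u hu => hM u (hseg hu)
    have hfun : (fun i => F z i - F (ζf t) i) = F z - F (ζf t) := by funext i; simp [Pi.sub_apply]
    rw [hfun]
    exact kernel_norm_le_of_margin_chord hm₀pos (hmargin z hz t) (hM _ (hζS t)) hdiff hMseg (hdist z hz t)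
  have hbound : IntegrableOn (fun _ : ℝ => m₀ ^ (-(3/2 : ℝ)) * (2 * M ^ 2 * R₁)) (Icc a b) :=
    (continuous_const).integrableOn_Icc
  exact differentiableOn_fixedSourcePiece (Metric.isOpen_ball) (hF.mono hballS) hP hD hGc measurableSet_Icc hpos hbound hdom

end Summit.NavierStokesRegularity.NavierStokesRegularity.Theorems.StadiumConnectorPiece

end
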